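/-
Copyright: the b2b-balaban T⁴-continuum CRUX team, row NE7b owner lineage `t4-ne7b-p1` (gen 115). Project licence.
-/
import Summits.QuantumFields.BalabanUV.T4Continuum.Spine.NE7b.OneShotChartWeightedRows
import Summits.QuantumFields.BalabanUV.T4Continuum.Spine.NE7b.FibreSupUniqueness

/-!
# THE NEXT-SCALE LINEARISED EQUATION MAP IS EXPONENTIALLY LOCAL: for the perturbed skeleton on `ℤ^d`, the coarse-lattice
# operator `R(w) := Q′∘(A + N′(σw))∘Dσ(w)` — the derivative of SIS's next equation map `Q′∘Eq∘σ` at the background, i.e. the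
# Lagrange-multiplier response of the constrained critical point — maps the WEIGHTED coarse space `ℓ^∞_{μ,ρ}` to itself with norm
# `≤ (e^{μ(n+1)}·c0·K_d(1) + λ)·K₁(μ)` whenever `Dσ(w)` obeys (63)'s weighted letter with constant `K₁(μ)`, and its dependence on the
# background field is weighted-Lipschitz with (64)'s letters: LOCALITY PROPAGATES THROUGH ONE RENORMALISATION STEP
# (row NE7b, node U5c; (62) + (52) BY NAME, generic in (63) ∕ (64)'s displayed letters; [folklore])

Cell `pub-balaban`, sub-cell `t4`, spine estimate NE7b (`T4WeightBudget.RelWeightBound`; the cell's OWN estimate — NOT PRINTED in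
[Bałaban 1983–89], NOT PROVED).  Crux-route work under `Spine/NE7b/` by the row OWNER (`t4-ne7b-p1` gen 115) under FREEZE (0)'s
crux-prover clause (FILING-CLAIM C-ne7bp1-g115-4); NOTHING of Bałaban's is named as a Lean object, valued or asserted; no
`T4Continuum/Support` leaf typed; no `def`, no notation; zero `sorry`.  Imports (BY NAME): the owner's (62) `…OneShotChartWeightedRows`
(`weighted_blockAvg`, `nonneg_of_weighted`, `abs_le_exp_neg_mul`) and (52) `…FibreSupUniqueness` (`abs_sum_AX_mul_le`: the row letter
`Σ_{r ∈ nbhd(p)}|A(p,r)|·R ≤ c0·K_d(1)·R` of the site matrix), the Literature columns `B6QGQLower276` (`AX`, `nbhd`, `blk`, `B`, `mem_B`,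
`dist_blk_le`, `dist_add_e_le`, `dist_sub_e_le`, `c0`), `B4Sect5Proof` (`latticeConst`).

WHY (located).  SIS (leaf-06 `…SupInductiveStep`, (c)) reads the NEXT equation map `Q′∘Eq∘σ` with derivative `Q′∘Eq′(σw)∘Dσ(w)` and
SIZE `‖Q′‖·B·K₁`; the tower (leaf-06 `…SupEquationTower`) iterates it.  What the iteration must propagate is LOCALITY, not size:
the next-scale linear operator must again have an exponentially decaying kernel on the coarse lattice, or the next chart's section
has no row letter and the next (62) cannot be written.  With (63) the response `Dσ(w)` is bounded between the weighted spaces;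
`A = Δ^η + aQ′*Q′` has FINITE RANGE (`nbhd(p)` = the block of `p` and its `2d` lattice neighbours, coarse distance `≤ n + 1` by
`dist_blk_le`), so it is bounded on every weighted space at the cost `e^{μ(n+1)}`; `N′` is diagonal and `Q′` weight-neutral.  Hence
`R(w)` is bounded on `ℓ^∞_{μ,ρ}(coarse)` — its kernel decays at the block scale at every admissible rate — and (64)'s difference
letters give its weighted Lipschitz dependence on `w`.  Everything is generic in the displayed letters (hypotheses), so (63) §4 ∕ (64)
§4 feed it with their `σ, Dσ` by `obtain` ∕ `choose`.

WHAT IS PROVED ([folklore]; `ℓ^∞ := lp (fun _ : X d => ℝ) ∞`; weights `ρ` with `ρ x − ρ y ≤ |x − y|`, `0 ≤ μ`):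
* §1 `dist_blk_le_of_mem_nbhd` (`r ∈ nbhd(p) ⇒ |blk p − blk r|_∞ ≤ n + 1`), `sum_abs_AX_le` (`Σ_{r ∈ nbhd(p)}|A(p,r)| ≤ c0·K_d(1)`).
* §2 **`weighted_AX`**: `e^{μρ(blk p)}|(Af)(p)| ≤ e^{μ(n+1)}·c0·K_d(1)·R` whenever `e^{μρ(blk q)}|f(q)| ≤ R` — the site operator is
  bounded on every weighted fine space (finite range); `weighted_diag` (`N′ = g·`, `|g| ≤ λ`: weight-neutral up to `λ`).
* §3 **`weighted_nextScale_of_letters`**: for `Q′, A` with the displayed actions, `N′ = g·` (`|g| ≤ λ`) and ANY `D : ℓ^∞ →L ℓ^∞` with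
  the weighted letter `e^{μρ(blk p)}|(Dv)(p)| ≤ K·R_v` (for `e^{μρ}|v| ≤ R_v`):
  **`e^{μρ(y)}|(Q′(A(Dv) + N′(Dv)))(y)| ≤ (e^{μ(n+1)}c0K_d(1) + λ)·K·R_v`** — the next-scale linearised equation map is bounded on
  `ℓ^∞_{μ,ρ}(coarse)`; `fine_nextScale_of_letters` (the fine field `A(Dv) + N′(Dv)` itself, weight `ρ∘blk`).
* §4 **`weighted_nextScale_sub_of_letters`**: for two responses `D, D′` and two multipliers `g, g′` with the difference letters of
  (64) §4 — `e^{μρ(blk p)}|((D − D′)v)(p)| ≤ R_Δ`, `e^{μρ(blk q)}|(g(q) − g′(q))·(D′v)(q)| ≤ R_s` —: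
  `e^{μρ(y)}|(Q′(A(Dv) + N′(Dv)) − Q′(A(D′v) + N″(D′v)))(y)| ≤ (e^{μ(n+1)}c0K_d(1) + λ)·R_Δ + R_s` — the next-scale operator's
  weighted Lipschitz dependence on the background.
* §5 toy: §1's row letter at `d = 1`.

HONEST (what this is NOT).  `c0(d,n,a)·K_d(1)·e^{μ(n+1)}` is side-dependent and useless by value (only finite range is used, as in
ASE's `exists_clm_AX`); the INVERSE of the next-scale operator (the next propagator) and its decay — the input of the next chart's
section — are NOT here (that is the next-scale (46)∕(49), a Combes–Thomas inversion on the coarse lattice, not typed); no torus,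
no covariant operators ((A3), NC-NE7b-α UNRULED), nothing of Bałaban's (A1c).  BY-NAME EFFECT ON THE WALL: NONE.  NE7b NOT PRINTED ∕
NOT PROVED; spine PROVED 0∕9; rung (B)+1 on a FINITE torus — NOT infinite volume, NOT the mass gap, NOT Clay.  HONEST DEPENDENCY:
continuum YM on T⁴ ⇐ BetaPertH ∧ nine spine estimates (0∕9 proved); BetaPertH ⇐ (D1) ∧ (D4) ∧ CAP+tail; G-an2-4 gates asym, D1 and
NE2∕3∕4.
-/

set_option autoImplicit false

namespace Summit.QuantumFields.BalabanUV.T4Continuum.NE7b.SupNextScaleLocality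

open scoped ENNReal
open Literature.MathematicalPhysics.QuantumFieldTheory.Balaban1983to89
open B4Sect5Proof (latticeConst latticeConst_nonneg)
open B6QGQLower276 (X blk B mem_B AX e c0 c0_pos dist_blk_le dist_add_e_le dist_sub_e_le)
open B5Hk103ScalarZd (nbhd)
open FibreSupUniqueness (abs_sum_AX_mul_le)
open OneShotChartWeightedRows (weighted_blockAvg nonneg_of_weighted abs_le_exp_neg_mul)

variable {d : ℕ}

/-! ## §1. The site matrix has finite range at the block scale -/

/-- **Finite range**: a site `r` in the row support `nbhd(p)` (the block of `p` and its `2d` lattice neighbours) has its block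
within coarse distance `n + 1` of the block of `p` (`dist_blk_le`; the sharp value is `1`, not needed). [folklore] -/
theorem dist_blk_le_of_mem_nbhd (n : ℕ) {p r : X d} (hr : r ∈ nbhd n p) : dist (blk n p) (blk n r) ≤ (n : ℝ) + 1 := by
  have hp : p ∈ B n (blk n p) := mem_B.2 rfl
  have hr' : r ∈ B n (blk n r) := mem_B.2 rfl
  have h := dist_blk_le hp hr'
  simp only [nbhd, Finset.mem_union, Finset.mem_image, Finset.mem_univ, true_and] at hr
  rcases hr with (hB | ⟨μ, rfl⟩) | ⟨μ, rfl⟩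
  · rw [mem_B.1 hB, dist_self]; positivity
  · linarith [dist_add_e_le p μ]
  · linarith [dist_sub_e_le p μ]

/-- **The absolute row letter of the site matrix**: `Σ_{r ∈ nbhd(p)} |A(p,r)| ≤ c0(d,n,a)·K_d(1)` ((52) `abs_sum_AX_mul_le` read on
the sign pattern of the row). [folklore] -/
theorem sum_abs_AX_le (n : ℕ) {a : ℝ} (ha : 0 < a) (p : X d) :
    ∑ r ∈ nbhd n p, |AX n a p r| ≤ c0 d n a * latticeConst d 1 := by
  have hs : ∀ r : X d, |(if 0 ≤ AX n a p r then (1 : ℝ) else -1)| ≤ 1 := fun r => by split_ifs <;> simp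
  have h := abs_sum_AX_mul_le n ha hs p
  rw [mul_one] at h
  refine le_trans (le_of_eq ?_) ((le_abs_self _).trans h)
  refine Finset.sum_congr rfl fun r _ => ?_
  split_ifs with hr
  · rw [mul_one, abs_of_nonneg hr]
  · rw [mul_neg, mul_one, abs_of_neg (lt_of_not_ge hr)]

/-! ## §2. The site operator and the diagonal on the weighted fine spaces -/

/-- **THE WEIGHTED LETTER OF THE SITE OPERATOR** (every `d`, `0 ≤ μ`): `e^{μρ(blk p)}|(Af)(p)| ≤ e^{μ(n+1)}·c0·K_d(1)·R` whenever
`e^{μρ(blk q)}|f(q)| ≤ R` — finite range costs the factor `e^{μ(n+1)}`. [folklore] -/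
theorem weighted_AX (n : ℕ) {a : ℝ} (ha : 0 < a) {μ : ℝ} (hμ0 : 0 ≤ μ) {ρ : X d → ℝ} (hρ : ∀ x y, ρ x - ρ y ≤ dist x y)
    {f : X d → ℝ} {R : ℝ} (hf : ∀ q, Real.exp (μ * ρ (blk n q)) * |f q| ≤ R) (p : X d) :
    Real.exp (μ * ρ (blk n p)) * |∑ r ∈ nbhd n p, AX n a p r * f r|
      ≤ Real.exp (μ * ((n : ℝ) + 1)) * (c0 d n a * latticeConst d 1) * R := by
  have hR : 0 ≤ R := nonneg_of_weighted hf
  have hE : 0 ≤ Real.exp (μ * ρ (blk n p)) := (Real.exp_pos _).le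
  -- on the row support the weight at `blk p` is at most `e^{μ(n+1)}` times the weight at `blk r`
  have hwt : ∀ r ∈ nbhd n p, Real.exp (μ * ρ (blk n p)) * |f r| ≤ Real.exp (μ * ((n : ℝ) + 1)) * R := by
    intro r hr
    have h1 : μ * ρ (blk n p) ≤ μ * ((n : ℝ) + 1) + μ * ρ (blk n r) := by
      have := mul_le_mul_of_nonneg_left ((hρ (blk n p) (blk n r)).trans (dist_blk_le_of_mem_nbhd n hr)) hμ0
      linarith
    calc Real.exp (μ * ρ (blk n p)) * |f r| ≤ Real.exp (μ * ((n : ℝ) + 1) + μ * ρ (blk n r)) * |f r| :=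
          mul_le_mul_of_nonneg_right (Real.exp_le_exp.2 h1) (abs_nonneg _)
      _ = Real.exp (μ * ((n : ℝ) + 1)) * (Real.exp (μ * ρ (blk n r)) * |f r|) := by rw [Real.exp_add, mul_assoc]
      _ ≤ Real.exp (μ * ((n : ℝ) + 1)) * R := mul_le_mul_of_nonneg_left (hf r) (Real.exp_pos _).le
  calc Real.exp (μ * ρ (blk n p)) * |∑ r ∈ nbhd n p, AX n a p r * f r|
      ≤ Real.exp (μ * ρ (blk n p)) * ∑ r ∈ nbhd n p, |AX n a p r| * |f r| := by
        refine mul_le_mul_of_nonneg_left ((Finset.abs_sum_le_sum_abs _ _).trans (le_of_eq ?_)) hE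
        exact Finset.sum_congr rfl fun r _ => abs_mul _ _
    _ = ∑ r ∈ nbhd n p, |AX n a p r| * (Real.exp (μ * ρ (blk n p)) * |f r|) := by
        rw [Finset.mul_sum]; exact Finset.sum_congr rfl fun r _ => by ring
    _ ≤ ∑ r ∈ nbhd n p, |AX n a p r| * (Real.exp (μ * ((n : ℝ) + 1)) * R) :=
        Finset.sum_le_sum fun r hr => mul_le_mul_of_nonneg_left (hwt r hr) (abs_nonneg _)
    _ = (∑ r ∈ nbhd n p, |AX n a p r|) * (Real.exp (μ * ((n : ℝ) + 1)) * R) := by rw [Finset.sum_mul]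
    _ ≤ (c0 d n a * latticeConst d 1) * (Real.exp (μ * ((n : ℝ) + 1)) * R) :=
        mul_le_mul_of_nonneg_right (sum_abs_AX_le n ha p) (by positivity)
    _ = _ := by ring

/-- The diagonal `N′ = g·` (`|g| ≤ λ`) is weight-neutral up to `λ`: `e^{μθ(q)}|g(q)h(q)| ≤ λ·R` whenever `e^{μθ(q)}|h(q)| ≤ R`.
[folklore] -/
theorem weighted_diag {μ : ℝ} {θ : X d → ℝ} {g h : X d → ℝ} {lam R : ℝ} (hg : ∀ q, |g q| ≤ lam)
    (hh : ∀ q, Real.exp (μ * θ q) * |h q| ≤ R) (q : X d) : Real.exp (μ * θ q) * |g q * h q| ≤ lam * R := by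
  have hlam : 0 ≤ lam := (abs_nonneg _).trans (hg q)
  rw [abs_mul, mul_left_comm]
  exact mul_le_mul (hg q) (hh q) (mul_nonneg (Real.exp_pos _).le (abs_nonneg _)) hlam

/-! ## §3. The next-scale linearised equation map on the weighted coarse space -/

/-- **The fine field of the next equation map, weighted**: for `A` with the displayed action, `N′ = g·` (`|g| ≤ λ`) and any response
`D` with the weighted letter of constant `K`, the fine field `A(Dv) + N′(Dv)` has `e^{μρ(blk p)}|·(p)| ≤ (e^{μ(n+1)}c0K_d(1) + λ)·K·R_v`.
[folklore] -/
theorem fine_nextScale_of_letters (n : ℕ) {a : ℝ} (ha : 0 < a)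
    (Aop Nop D : lp (fun _ : X d => ℝ) ∞ →L[ℝ] lp (fun _ : X d => ℝ) ∞)
    (hA : ∀ (f : lp (fun _ : X d => ℝ) ∞) (p : X d), Aop f p = ∑ r ∈ nbhd n p, AX n a p r * f r)
    {g : X d → ℝ} {lam : ℝ} (hN : ∀ (f : lp (fun _ : X d => ℝ) ∞) (p : X d), Nop f p = g p * f p) (hg : ∀ p, |g p| ≤ lam)
    {μ : ℝ} (hμ0 : 0 ≤ μ) {ρ : X d → ℝ} (hρ : ∀ x y, ρ x - ρ y ≤ dist x y) {K : ℝ}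
    (hD : ∀ (v : lp (fun _ : X d => ℝ) ∞) (Rv : ℝ), (∀ y, Real.exp (μ * ρ y) * |v y| ≤ Rv) →
      ∀ p : X d, Real.exp (μ * ρ (blk n p)) * |D v p| ≤ K * Rv)
    (v : lp (fun _ : X d => ℝ) ∞) {Rv : ℝ} (hv : ∀ y, Real.exp (μ * ρ y) * |v y| ≤ Rv) (p : X d) :
    Real.exp (μ * ρ (blk n p)) * |(Aop (D v) + Nop (D v)) p|
      ≤ (Real.exp (μ * ((n : ℝ) + 1)) * (c0 d n a * latticeConst d 1) + lam) * (K * Rv) := by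
  have hDv : ∀ q, Real.exp (μ * ρ (blk n q)) * |D v q| ≤ K * Rv := hD v Rv hv
  have h1 := weighted_AX n ha hμ0 hρ hDv p
  have h2 := weighted_diag (θ := fun q => ρ (blk n q)) hg hDv p
  have hE : 0 ≤ Real.exp (μ * ρ (blk n p)) := (Real.exp_pos _).le
  rw [lp.coeFn_add, Pi.add_apply, hA, hN]
  calc _ ≤ Real.exp (μ * ρ (blk n p)) * (|∑ r ∈ nbhd n p, AX n a p r * D v r| + |g p * D v p|) :=
        mul_le_mul_of_nonneg_left (abs_add_le _ _) hE
    _ ≤ Real.exp (μ * ((n : ℝ) + 1)) * (c0 d n a * latticeConst d 1) * (K * Rv) + lam * (K * Rv) := by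
        rw [mul_add]; exact add_le_add h1 h2
    _ = _ := by ring

/-- **THE NEXT-SCALE LINEARISED EQUATION MAP IS BOUNDED ON THE WEIGHTED COARSE SPACE**: for `Q′, A` with the displayed actions,
`N′ = g·` (`|g| ≤ λ`) and ANY response `D` with (63)'s weighted letter of constant `K`,
`e^{μρ(y)}|(Q′(A(Dv) + N′(Dv)))(y)| ≤ (e^{μ(n+1)}c0K_d(1) + λ)·K·R_v` whenever `e^{μρ(y)}|v(y)| ≤ R_v` — the coarse operator
`R(w) = Q′∘(A + N′(σw))∘Dσ(w)` has an exponentially decaying kernel at every admissible rate: LOCALITY PROPAGATES THROUGH THE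
STEP. [folklore] -/
theorem weighted_nextScale_of_letters (n : ℕ) {a : ℝ} (ha : 0 < a)
    (Dop Aop Nop D : lp (fun _ : X d => ℝ) ∞ →L[ℝ] lp (fun _ : X d => ℝ) ∞)
    (hDop : ∀ (f : lp (fun _ : X d => ℝ) ∞) (y : X d), Dop f y = (((n : ℝ) + 1) ^ d)⁻¹ * ∑ p ∈ B n y, f p)
    (hA : ∀ (f : lp (fun _ : X d => ℝ) ∞) (p : X d), Aop f p = ∑ r ∈ nbhd n p, AX n a p r * f r)
    {g : X d → ℝ} {lam : ℝ} (hN : ∀ (f : lp (fun _ : X d => ℝ) ∞) (p : X d), Nop f p = g p * f p) (hg : ∀ p, |g p| ≤ lam)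
    {μ : ℝ} (hμ0 : 0 ≤ μ) {ρ : X d → ℝ} (hρ : ∀ x y, ρ x - ρ y ≤ dist x y) {K : ℝ}
    (hD : ∀ (v : lp (fun _ : X d => ℝ) ∞) (Rv : ℝ), (∀ y, Real.exp (μ * ρ y) * |v y| ≤ Rv) →
      ∀ p : X d, Real.exp (μ * ρ (blk n p)) * |D v p| ≤ K * Rv)
    (v : lp (fun _ : X d => ℝ) ∞) {Rv : ℝ} (hv : ∀ y, Real.exp (μ * ρ y) * |v y| ≤ Rv) (y : X d) :
    Real.exp (μ * ρ y) * |Dop (Aop (D v) + Nop (D v)) y|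
      ≤ (Real.exp (μ * ((n : ℝ) + 1)) * (c0 d n a * latticeConst d 1) + lam) * (K * Rv) := by
  rw [hDop]
  exact weighted_blockAvg n (f := fun p => (Aop (D v) + Nop (D v)) p)
    (fun p => fine_nextScale_of_letters n ha Aop Nop D hA hN hg hμ0 hρ hD v hv p) y

/-! ## §4. The next-scale map's weighted dependence on the background -/

/-- **THE NEXT-SCALE OPERATOR DEPENDS ON THE BACKGROUND WEIGHTED-LIPSCHITZ**: for two responses `D, D′` and two multipliers `g, g′`
(`|g| ≤ λ`) with the DIFFERENCE letters of (64) §4 — `e^{μρ(blk p)}|((D − D′)v)(p)| ≤ R_Δ` and `e^{μρ(blk q)}|(g(q) − g′(q))·(D′v)(q)| ≤ R_s` —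
`e^{μρ(y)}|(Q′(A(Dv) + N′(Dv)) − Q′(A(D′v) + N″(D′v)))(y)| ≤ (e^{μ(n+1)}c0K_d(1) + λ)·R_Δ + R_s`; the identity used is
`(A + N′)Dv − (A + N″)D′v = (A + N′)(Dv − D′v) + (g − g′)·D′v`. [folklore] -/
theorem weighted_nextScale_sub_of_letters (n : ℕ) {a : ℝ} (ha : 0 < a)
    (Dop Aop Nop Nop' D D' : lp (fun _ : X d => ℝ) ∞ →L[ℝ] lp (fun _ : X d => ℝ) ∞)
    (hDop : ∀ (f : lp (fun _ : X d => ℝ) ∞) (y : X d), Dop f y = (((n : ℝ) + 1) ^ d)⁻¹ * ∑ p ∈ B n y, f p)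
    (hA : ∀ (f : lp (fun _ : X d => ℝ) ∞) (p : X d), Aop f p = ∑ r ∈ nbhd n p, AX n a p r * f r)
    {g g' : X d → ℝ} {lam : ℝ} (hN : ∀ (f : lp (fun _ : X d => ℝ) ∞) (p : X d), Nop f p = g p * f p)
    (hN' : ∀ (f : lp (fun _ : X d => ℝ) ∞) (p : X d), Nop' f p = g' p * f p) (hg : ∀ p, |g p| ≤ lam)
    {μ : ℝ} (hμ0 : 0 ≤ μ) {ρ : X d → ℝ} (hρ : ∀ x y, ρ x - ρ y ≤ dist x y) (v : lp (fun _ : X d => ℝ) ∞) {RΔ Rs : ℝ}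
    (hΔ : ∀ p : X d, Real.exp (μ * ρ (blk n p)) * |(D v - D' v) p| ≤ RΔ)
    (hs : ∀ q : X d, Real.exp (μ * ρ (blk n q)) * |(g q - g' q) * D' v q| ≤ Rs) (y : X d) :
    Real.exp (μ * ρ y) * |(Dop (Aop (D v) + Nop (D v)) - Dop (Aop (D' v) + Nop' (D' v))) y|
      ≤ (Real.exp (μ * ((n : ℝ) + 1)) * (c0 d n a * latticeConst d 1) + lam) * RΔ + Rs := by
  -- the fine difference, sitewise: `(A + g·)(Dv − D′v) + (g − g′)·D′v`
  have hfine : ∀ p : X d, Real.exp (μ * ρ (blk n p)) * |((Aop (D v) + Nop (D v)) - (Aop (D' v) + Nop' (D' v))) p|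
      ≤ (Real.exp (μ * ((n : ℝ) + 1)) * (c0 d n a * latticeConst d 1) + lam) * RΔ + Rs := by
    intro p
    have h1 := weighted_AX n ha hμ0 hρ hΔ p
    have h2 := weighted_diag (θ := fun q => ρ (blk n q)) hg hΔ p
    have h3 := hs p
    have hE : 0 ≤ Real.exp (μ * ρ (blk n p)) := (Real.exp_pos _).le
    have e : ((Aop (D v) + Nop (D v)) - (Aop (D' v) + Nop' (D' v))) p
        = (∑ r ∈ nbhd n p, AX n a p r * (D v - D' v) r) + g p * (D v - D' v) p + (g p - g' p) * D' v p := by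
      have hs : ∑ r ∈ nbhd n p, AX n a p r * (D v - D' v) r
          = ∑ r ∈ nbhd n p, AX n a p r * D v r - ∑ r ∈ nbhd n p, AX n a p r * D' v r := by
        rw [← Finset.sum_sub_distrib]
        exact Finset.sum_congr rfl fun r _ => by rw [lp.coeFn_sub, Pi.sub_apply, mul_sub]
      rw [hs]
      simp only [lp.coeFn_sub, lp.coeFn_add, Pi.sub_apply, Pi.add_apply, hA, hN, hN']
      ring
    rw [e]
    calc _ ≤ Real.exp (μ * ρ (blk n p)) * ((|∑ r ∈ nbhd n p, AX n a p r * (D v - D' v) r| + |g p * (D v - D' v) p|)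
            + |(g p - g' p) * D' v p|) :=
          mul_le_mul_of_nonneg_left ((abs_add_le _ _).trans (add_le_add (abs_add_le _ _) le_rfl)) hE
      _ ≤ (Real.exp (μ * ((n : ℝ) + 1)) * (c0 d n a * latticeConst d 1) * RΔ + lam * RΔ) + Rs := by
          rw [mul_add, mul_add]; exact add_le_add (add_le_add h1 h2) h3
      _ = _ := by ring
  rw [← map_sub, hDop]
  exact weighted_blockAvg n (f := fun p => ((Aop (D v) + Nop (D v)) - (Aop (D' v) + Nop' (D' v))) p) hfine y

/-! ## §5. Toy -/

/-- Toy: the site matrix's absolute row letter on `ℤ¹` with block side `2`. -/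
example {a : ℝ} (ha : 0 < a) (p : X 1) : ∑ r ∈ nbhd 1 p, |AX 1 a p r| ≤ c0 1 1 a * latticeConst 1 1 :=
  sum_abs_AX_le 1 ha p

end Summit.QuantumFields.BalabanUV.T4Continuum.NE7b.SupNextScaleLocality
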